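import Mathlib
import HarnessLib
import Summits.QuantumFields.YangMills.Theorems.PencilRigidityCurvatureKernelBoundKernelPinning
import Summits.QuantumFields.YangMills.Theorems.PencilRigidityCurvatureKernelBoundKernelOffDiagonalFrames
import Summits.QuantumFields.YangMills.Theorems.PencilRigidityKernelTransfer

/-!
# `CurvatureKernelBound` — stub B support: symmetries of a complex representing kernel

Support file for crux `stmt-QuantumFields-11687` (`PencilRigidity.CurvatureKernelBound`), line
`sixteen-charts-analytic-kernel`, stub `AxisEnvelope` (B).

Let `K : ℝ⁴ → ℂ` be continuous off `0` and represent the two-point functional `𝔖₂` on `⁰𝒮`,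
`𝔖₂(F) = ∫ K(x₀ - x₁) F(x) dx`.  (The tree's `Theorems.KernelTransfer` files treat REAL kernels;
here the kernel is complex, and the statements below are the complex re-typings.)

* `rep_pullback_complex`: the family pulled back by a linear isometry `R` is represented on `⁰𝒮`
  by `K ∘ R` (change of variables, `KernelTransfer.integral_comp_isometry_two`);
* `kernel_apply_linearIsometryEquiv` / sub-goal `KernelIsometryInvariance`: if `R` is a symmetry
  of `𝔖₂` on `⁰𝒮` then `K (R x) = K x` off `0` (kernel uniqueness `kernel_unique_of_realTensor`);
* `kernel_neg`: a family invariant under proper signed permutations on `⁰𝒮` has an even kernel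
  (`-1` is a proper signed permutation of `ℝ⁴`, `KernelTransfer.det_neg_eq_one`);
* `exists_axis_transport`: for every `μ` and `x ≠ 0` there is `y` with `y₀ = x_μ`, `‖y‖ = ‖x‖`,
  `K y = K x` (transport by a proper signed permutation `P` with `P e₀ = e_μ`,
  `exists_signedPerm_frame`);
* `exists_coord_norm_div_two_le`: `‖x‖ / 2 ≤ |x_μ| ≠ 0` for a maximal coordinate `μ`. [folklore]
-/

noncomputable section

open scoped BigOperators Topology SchwartzMap ComplexConjugate InnerProductSpace
open MeasureTheory Filter Set
open Literature.MathematicalPhysics.QuantumLattice Literature.MathematicalPhysics.AQFT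
open Literature.MathematicalPhysics.QuantumFieldTheory
open Summit.QuantumFields.YangMills.Theorems.KernelTransfer

namespace Summit.QuantumFields.YangMills.Theorems.CurvatureKernel

/-! ## Pull-back of the representation by a linear isometry -/

/-- **Pull-back of the two-point representation (complex kernel).** If `𝔖₂(F) = ∫ K(x₀ - x₁) F`
on `⁰𝒮`, then `F ↦ 𝔖₂(F ∘ R⁻¹)` is represented on `⁰𝒮` by the kernel `K ∘ R`. [folklore] -/
theorem rep_pullback_complex {S : SchwingerFamily (EuclideanSpace ℝ (Fin 4))}
    {K : (EuclideanSpace ℝ (Fin 4)) → ℂ}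
    (hrep : ∀ F : 𝓢((Fin 2 → EuclideanSpace ℝ (Fin 4)), ℂ), IsOffDiagonal F →
      Integrable (fun x : Fin 2 → (EuclideanSpace ℝ (Fin 4)) => K (x 0 - x 1) * F x) ∧
        S 2 F = ∫ x : Fin 2 → (EuclideanSpace ℝ (Fin 4)), K (x 0 - x 1) * F x)
    (R : (EuclideanSpace ℝ (Fin 4)) ≃ₗᵢ[ℝ] (EuclideanSpace ℝ (Fin 4)))
    (F : 𝓢((Fin 2 → EuclideanSpace ℝ (Fin 4)), ℂ)) (hF : IsOffDiagonal F) :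
    Integrable (fun x : Fin 2 → (EuclideanSpace ℝ (Fin 4)) => K (R (x 0 - x 1)) * F x) ∧
      S 2 (linActMulti R F) = ∫ x : Fin 2 → (EuclideanSpace ℝ (Fin 4)), K (R (x 0 - x 1)) * F x := by
  obtain ⟨hint, hS⟩ := hrep (linActMulti R F) (isOffDiagonal_linActMulti_two hF R)
  have hfun : (fun x : Fin 2 → (EuclideanSpace ℝ (Fin 4)) => K (R (x 0 - x 1)) * F x) =
      fun x => (fun y : Fin 2 → (EuclideanSpace ℝ (Fin 4)) => K (y 0 - y 1) * linActMulti R F y)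
        (fun i => R (x i)) := by
    funext x
    simp only [linActMulti_apply, LinearIsometryEquiv.symm_apply_apply, map_sub]
  refine ⟨?_, ?_⟩
  · rw [hfun]
    exact integrable_comp_isometry_two R hint
  · rw [hS, hfun]
    exact (integral_comp_isometry_two R
      (fun y : Fin 2 → (EuclideanSpace ℝ (Fin 4)) => K (y 0 - y 1) * linActMulti R F y)).symm

/-! ## Symmetries of the two-point functional are symmetries of the kernel -/

/-- **A symmetry of `𝔖₂` on `⁰𝒮` is a symmetry of its kernel.** If `K` is continuous off `0` and
represents `𝔖₂` on `⁰𝒮`, and `𝔖₂(F ∘ R⁻¹) = 𝔖₂(F)` for all `F ∈ ⁰𝒮`, then `K (R x) = K x` for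
`x ≠ 0` (both `K ∘ R` and `K` represent `𝔖₂`; `kernel_unique_of_realTensor`). [folklore] -/
theorem kernel_apply_linearIsometryEquiv (S₁ : SchwingerFamily (EuclideanSpace ℝ (Fin 4)))
    (K : (EuclideanSpace ℝ (Fin 4)) → ℂ) (hK : ContinuousOn K {x : (EuclideanSpace ℝ (Fin 4)) | x ≠ 0})
    (hrep : ∀ F : 𝓢((Fin 2 → EuclideanSpace ℝ (Fin 4)), ℂ), IsOffDiagonal F →
      Integrable (fun x : Fin 2 → (EuclideanSpace ℝ (Fin 4)) => K (x 0 - x 1) * F x) ∧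
        S₁ 2 F = ∫ x : Fin 2 → (EuclideanSpace ℝ (Fin 4)), K (x 0 - x 1) * F x)
    (R : (EuclideanSpace ℝ (Fin 4)) ≃ₗᵢ[ℝ] (EuclideanSpace ℝ (Fin 4)))
    (hR : ∀ F : 𝓢((Fin 2 → EuclideanSpace ℝ (Fin 4)), ℂ), IsOffDiagonal F →
      S₁ 2 (linActMulti R F) = S₁ 2 F) :
    ∀ x : EuclideanSpace ℝ (Fin 4), x ≠ 0 → K (R x) = K x := by
  have hK' : ContinuousOn (fun x => K (R x)) {x : (EuclideanSpace ℝ (Fin 4)) | x ≠ 0} := by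
    refine hK.comp R.continuous.continuousOn fun x hx => ?_
    simp only [mem_setOf_eq] at hx ⊢
    exact fun h => hx (R.map_eq_zero_iff.1 h)
  have h := kernel_unique_of_realTensor (K := fun x => K (R x)) (K' := K) hK' hK
    (fun f F _ hoff _ _ => by
      obtain ⟨hint, hSF⟩ := hrep F hoff
      obtain ⟨hintR, hSFR⟩ := rep_pullback_complex hrep R F hoff
      refine ⟨hintR, hint, ?_⟩
      show ∫ y : Fin 2 → EuclideanSpace ℝ (Fin 4), K (R (y 0 - y 1)) * F y = _
      rw [← hSFR, hR F hoff, hSF])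
  intro x hx
  exact h x hx

/-! ## Proper signed permutations: evenness and axis transport -/

/-- **Evenness.** A kernel continuous off `0` representing `𝔖₂` on `⁰𝒮` for a family invariant
under proper signed permutations on `⁰𝒮` is even: `K (-x) = K x` for `x ≠ 0` (`-1` is a proper
signed permutation of `ℝ⁴`). [folklore] -/
theorem kernel_neg (S₁ : SchwingerFamily (EuclideanSpace ℝ (Fin 4)))
    (K : (EuclideanSpace ℝ (Fin 4)) → ℂ) (hK : ContinuousOn K {x : (EuclideanSpace ℝ (Fin 4)) | x ≠ 0})
    (hrep : ∀ F : 𝓢((Fin 2 → EuclideanSpace ℝ (Fin 4)), ℂ), IsOffDiagonal F →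
      Integrable (fun x : Fin 2 → (EuclideanSpace ℝ (Fin 4)) => K (x 0 - x 1) * F x) ∧
        S₁ 2 F = ∫ x : Fin 2 → (EuclideanSpace ℝ (Fin 4)), K (x 0 - x 1) * F x)
    (hH : ∀ (R : (EuclideanSpace ℝ (Fin 4)) ≃ₗᵢ[ℝ] (EuclideanSpace ℝ (Fin 4))),
      LinearMap.det (R.toLinearEquiv : (EuclideanSpace ℝ (Fin 4)) →ₗ[ℝ] (EuclideanSpace ℝ (Fin 4))) = 1 →
      (∀ i : Fin 4, ∃ j : Fin 4, R (EuclideanSpace.single i 1) = EuclideanSpace.single j 1 ∨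
        R (EuclideanSpace.single i 1) = -EuclideanSpace.single j 1) →
      ∀ (n : ℕ) (F : 𝓢((Fin n → (EuclideanSpace ℝ (Fin 4))), ℂ)), IsOffDiagonal F →
        S₁ n (linActMulti R F) = S₁ n F) :
    ∀ x : EuclideanSpace ℝ (Fin 4), x ≠ 0 → K (-x) = K x := by
  intro x hx
  have h := kernel_apply_linearIsometryEquiv S₁ K hK hrep (LinearIsometryEquiv.neg ℝ)
    (fun F hF => hH _ det_neg_eq_one neg_single 2 F hF) x hx
  simpa using h

/-- **Axis transport.** Under the same hypotheses, for every coordinate `μ` and `x ≠ 0` there is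
`y ≠ 0` with `y₀ = x_μ`, `‖y‖ = ‖x‖` and `K y = K x`: `y = P⁻¹ x` for a proper signed
permutation `P` with `P e₀ = e_μ`. [folklore] -/
theorem exists_axis_transport (S₁ : SchwingerFamily (EuclideanSpace ℝ (Fin 4)))
    (K : (EuclideanSpace ℝ (Fin 4)) → ℂ) (hK : ContinuousOn K {x : (EuclideanSpace ℝ (Fin 4)) | x ≠ 0})
    (hrep : ∀ F : 𝓢((Fin 2 → EuclideanSpace ℝ (Fin 4)), ℂ), IsOffDiagonal F →
      Integrable (fun x : Fin 2 → (EuclideanSpace ℝ (Fin 4)) => K (x 0 - x 1) * F x) ∧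
        S₁ 2 F = ∫ x : Fin 2 → (EuclideanSpace ℝ (Fin 4)), K (x 0 - x 1) * F x)
    (hH : ∀ (R : (EuclideanSpace ℝ (Fin 4)) ≃ₗᵢ[ℝ] (EuclideanSpace ℝ (Fin 4))),
      LinearMap.det (R.toLinearEquiv : (EuclideanSpace ℝ (Fin 4)) →ₗ[ℝ] (EuclideanSpace ℝ (Fin 4))) = 1 →
      (∀ i : Fin 4, ∃ j : Fin 4, R (EuclideanSpace.single i 1) = EuclideanSpace.single j 1 ∨
        R (EuclideanSpace.single i 1) = -EuclideanSpace.single j 1) →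
      ∀ (n : ℕ) (F : 𝓢((Fin n → (EuclideanSpace ℝ (Fin 4))), ℂ)), IsOffDiagonal F →
        S₁ n (linActMulti R F) = S₁ n F)
    (μ : Fin 4) (x : EuclideanSpace ℝ (Fin 4)) (hx : x ≠ 0) :
    ∃ y : EuclideanSpace ℝ (Fin 4), y ≠ 0 ∧ y 0 = x μ ∧ ‖y‖ = ‖x‖ ∧ K y = K x := by
  obtain ⟨ν, hν⟩ := exists_ne μ
  obtain ⟨P, hdet, hsign, h0, -⟩ := exists_signedPerm_frame μ ν hν.symm (s := 1) (t := 1)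
    (Or.inl rfl) (Or.inl rfl)
  refine ⟨P.symm x, fun h => hx (by simpa using congrArg P h), ?_, P.symm.norm_map x, ?_⟩
  · rw [← inner_single_zero_one (P.symm x), ← P.inner_map_map, P.apply_symm_apply, h0, one_smul,
      EuclideanSpace.inner_single_right]
    simp
  · have h := kernel_apply_linearIsometryEquiv S₁ K hK hrep P
      (fun F hF => hH P hdet hsign 2 F hF) (P.symm x) (fun h => hx (by simpa using congrArg P h))
    rw [P.apply_symm_apply] at h
    exact h.symm

/-! ## The largest coordinate controls the norm -/

/-- On `ℝ⁴`, `‖x‖ / 2 ≤ |x_μ|` for a coordinate `μ` maximising `|x_μ|`, and `x_μ ≠ 0` if `x ≠ 0`.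
[folklore] -/
theorem exists_coord_norm_div_two_le (x : EuclideanSpace ℝ (Fin 4)) (hx : x ≠ 0) :
    ∃ μ : Fin 4, x μ ≠ 0 ∧ ‖x‖ / 2 ≤ |x μ| := by
  obtain ⟨μ, -, hμ⟩ := Finset.exists_max_image Finset.univ (fun i : Fin 4 => |x i|) Finset.univ_nonempty
  have hsq : ‖x‖ ^ 2 ≤ (2 * |x μ|) ^ 2 := by
    rw [EuclideanSpace.norm_sq_eq]
    calc ∑ i, ‖x i‖ ^ 2 ≤ ∑ _i : Fin 4, |x μ| ^ 2 :=
          Finset.sum_le_sum fun i _ => by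
            rw [Real.norm_eq_abs]
            exact pow_le_pow_left₀ (abs_nonneg _) (hμ i (Finset.mem_univ i)) 2
      _ = (2 * |x μ|) ^ 2 := by rw [Finset.sum_const, Finset.card_univ, Fintype.card_fin]; ring
  have hle : ‖x‖ ≤ 2 * |x μ| :=
    (pow_le_pow_iff_left₀ (norm_nonneg x) (by positivity) two_ne_zero).1 hsq
  refine ⟨μ, fun h0 => hx ?_, by linarith⟩
  have hn : ‖x‖ ≤ 0 := by rw [h0, abs_zero, mul_zero] at hle; exact hle
  exact norm_le_zero_iff.1 hn

/-- **Sub-goal `KernelIsometryInvariance`** (helper for stub `AxisEnvelope`): a symmetry `R` of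
`𝔖₂` on `⁰𝒮` is a symmetry of any continuous-off-`0` complex representing kernel, `K ∘ R = K`
off `0`. [folklore] -/
theorem KernelIsometryInvariance : open Literature.MathematicalPhysics.QuantumLattice Literature.MathematicalPhysics.AQFT in ∀ (S₁ : SchwingerFamily (EuclideanSpace ℝ (Fin 4))) (K : (EuclideanSpace ℝ (Fin 4)) → ℂ), ContinuousOn K {x : (EuclideanSpace ℝ (Fin 4)) | x ≠ 0} → (∀ F : SchwartzMap (Fin 2 → (EuclideanSpace ℝ (Fin 4))) ℂ, IsOffDiagonal F → MeasureTheory.Integrable (fun x : Fin 2 → (EuclideanSpace ℝ (Fin 4)) => K (x 0 - x 1) * F x) ∧ S₁ 2 F = ∫ x : Fin 2 → (EuclideanSpace ℝ (Fin 4)), K (x 0 - x 1) * F x) → ∀ (R : (EuclideanSpace ℝ (Fin 4)) ≃ₗᵢ[ℝ] (EuclideanSpace ℝ (Fin 4))), (∀ F : SchwartzMap (Fin 2 → (EuclideanSpace ℝ (Fin 4))) ℂ, IsOffDiagonal F → S₁ 2 (linActMulti R F) = S₁ 2 F) → ∀ x : (EuclideanSpace ℝ (Fin 4)), x ≠ 0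 → K (R x) = K x := by
  intro S₁ K hK hrep R hR
  exact kernel_apply_linearIsometryEquiv S₁ K hK hrep R hR

end Summit.QuantumFields.YangMills.Theorems.CurvatureKernel

end
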